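import Summits.AtomisticToContinuum.FouriersLaw.Theorems.BondHeatUncertaintyExtensiveSnapshotIrreversibilityEnergyWindowHessianSplitD
import Summits.AtomisticToContinuum.FouriersLaw.Theorems.BondHeatUncertaintyExtensiveSnapshotIrreversibilityEnergyWindowSkeletonGramLimit

/-!
# Bond heat uncertainty — node «ScoreOrderLadder», part U: the score dual bound (MD₂) graded by
  DERIVATIVE ORDER; the Gram-conditional skeleton pieces (RW₁), (RW₂ᵈ); the order-2 junction

Cell `decomp-a2c`, lens «grading / quantitative ladder», generation 85 (critic row 1202 (3):
«type (SW⁰₂) and the junction (MD₂) ⟸ (MC∞) ∧ (SW⁰₂), signature first»).  The tree's (MD₂)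
`DensityScoreDualBound₂` (part D of «HessianSplit») bounds FOUR bath-momentum derivatives of the
smooth transition density `p(s, x, y)` of the chain with baths `T ± δ/2` in the dual `L^q(P_s(z,dy))`
form: `i = 0, 2` the FIRST derivatives (departure `∂_{x_b}`, arrival `∂_{y_b}`), `i = 1, 3` the
SECOND ones.  This part grades (MD₂) by the order of the derivative and types what the skeleton
machinery of the tree (parts W-0 … W-3: skeleton Gaussian integration by parts, the regularised
Skorokhod weights `w_{m,κ} = δ_m(Jᵀ(Γ_m+κ)⁻¹e)`, their defects, the law of `E_m`) needs BEYOND the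
inverse moments of the skeleton Gram matrices — the currency (MC∞) `SkeletonGramLimitInverseMoments`
PROVED in generation 84:

§1 `DensityScoreDualBoundOn I` — (MD₂) restricted to an index set `I ⊆ Fin 4` (body
  `densityScoreDualBodyOn I ω₂ lam β γ` at fixed chain parameters); (SD₁)
  `DensityScoreDualBoundFirst := …On {0, 2}`, (SD₂) `DensityScoreDualBoundSecond := …On {1, 3}`;
  ★ `densityScoreDualBound₂_of_orders : (SD₁) → (SD₂) → (MD₂)` and the converses (PROVED: a case
  split, `δ₀ = min`, `C = max`).  Both halves are WEAKER than (MD₂) (literal restrictions).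
§2 (RW₁) `GramControlledWeightMoments` — the ORDER-1 skeleton piece, GRAM-CONDITIONAL and
  LEVEL-WISE: at every level `m`, every regularisation `κ > 0`, GIVEN a measurable frame minorant
  `Λ` of `Γ_m + κ` along the path (`Λ|a|² ≤ aᵀ(Γ_m+κ)a`) whose inverse `q'`-moment is
  `≤ (C₁ e^{ε'H(z)})^{q'}`, the `q`-th moments of BOTH regularised weights (arrival `w_{m,κ}`,
  departure `w'_{m,κ}`, baths `T ± δ/2`, `s ∈ [½,1]`, `|δ| < δ₀`) are `≤ (K (1+C₁)^μ e^{εH(z)})^q`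
  with `q', ε', δ₀, K, μ` depending on `(T, N, q, ε)` only — NOT on `κ`, `m`, `C₁`, `z`.  This is
  pure finite-dimensional Gaussian `L^q`-calculus of the explicit functionals `⟨(Γ+κ)⁻¹e, Jx⟩ −
  2^{-m} div(Jᵀ(Γ+κ)⁻¹e)` (Hölder with `‖(Γ_m+κ)⁻¹‖ ≤ Λ⁻¹`; the level-uniform `L^{2q}` bound of
  the Riemann–Itô sum `Jx = Σ_j ∂_jE_m x_j` by the adapted factorisation `J_{s←0}(J_{t_j←0}⁻¹σ)`
  and a discrete Burkholder inequality; second-variation moments for the divergence): the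
  Hörmander / Norris content is REMOVED — it enters only through the hypothesis on `Λ`, which the
  junction (part V) discharges from (MC∞) via the tree's (MC∞) ⇒ (MC⁰_κ)
  (`skeletonGramInverseMomentsRegBody_of_limit`, constant uniform in `κ`).
§3 (RW₂ᵈ) `GramConditionalScoreDualSecond` — the ORDER-2 piece in CONDITIONAL DUAL form: at fixed
  chain parameters, the (MC∞) body implies the order-2 inequalities (SD₂).  WEAKER than (SD₂)
  (literally), equivalent to it modulo the proved (MC∞): an honest RESIDUAL, not yet a reduction —
  the native level-wise form (second-order weights `w² − 2^{-m}⟨∇w, u⟩` and the order-2 skeleton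
  identity with its two defects) needs third-variation moments absent from the tree and is the
  next generation's typing target (memo NODE-g85 §6).
§4 (SW⁰₂) `SkeletonWeightControl₂ := (RW₁) ∧ (RW₂ᵈ)` and ★ the order-2 junction
  `densityScoreDualBoundSecond_of_gram : (MC∞) → (RW₂ᵈ) → (SD₂)` (PROVED, modus ponens at fixed
  parameters).  The order-1 junction `(MC∞) → (RW₁) → (SD₁)` (Hölder on the Wiener pair through
  the tree's path-level arrival/departure bounds, integration by parts in `y_b`, differentiation
  under `∫ dy` in `x_b`) and the headline `(MC∞) → (SW⁰₂) → (MD₂)` are part V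
  (`…EnergyWindowScoreOrderOneGlue`).
No new instance / notation / option; no proof holes.  References: D. Nualart, *The Malliavin
Calculus and Related Topics* (2006), Prop. 1.3.1, Prop. 1.5.4, Prop. 2.1.4, §2.3; S. Kusuoka,
D. Stroock, J. Fac. Sci. Univ. Tokyo 32 (1985) 1–76, Thm 2.19; N. Cuneo, J.-P. Eckmann, M. Hairer,
L. Rey-Bellet, Electron. J. Probab. 23 (2018) no. 55, Prop. 3.2; D. L. Burkholder, Ann. Probab. 1
(1973) 19–42 (discrete martingale transforms).
-/

noncomputable section

namespace Summit.AtomisticToContinuum.FouriersLaw.Theorems.ExtensiveSnapshotIrreversibility.EnergyWindow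

open MeasureTheory Filter Topology Set
open scoped ENNReal NNReal Matrix ContDiff
open Literature.MathematicalPhysics.KineticTheory.HeatConduction Literature.Probability.Process

/-! ## 1. (MD₂) graded by derivative order -/

/-- The body of the score dual bound at fixed chain parameters, RESTRICTED to the derivative
indices `i ∈ I` (`0, 1` departure `∂_{x_b}, ∂²_{x_b}`; `2, 3` arrival `∂_{y_b}, ∂²_{y_b}`):
literally the text of (MD₂) `DensityScoreDualBound₂` with `∀ i : Fin 4` replaced by `∀ i ∈ I`.
[folklore] -/
def densityScoreDualBodyOn (I : Set (Fin 4)) (ω₂ lam β γ : ℝ) : Prop :=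
  ∀ T : ℝ, 0 < T → ∀ (N : ℕ) (hN : 2 ≤ N), ∀ r ε : ℝ, 1 < r → 0 < ε →
    ∃ δ₀ C : ℝ, 0 < δ₀ ∧ 0 ≤ C ∧ ∀ δ : ℝ, |δ| < δ₀ →
      ∀ p : ℝ → PhaseSpace N → PhaseSpace N → ℝ,
        IsTransitionDensity ω₂ lam β γ N (T + δ / 2) (T - δ / 2) p →
        ∀ s : ℝ, 1 / 2 ≤ s → s ≤ 1 → ∀ b : Fin N, (b = leftBath N hN ∨ b = rightBath N hN) →
          ∀ z : PhaseSpace N, ∀ G : PhaseSpace N → ℝ, ContDiff ℝ ∞ G → HasCompactSupport G →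
            ∀ i ∈ I,
              |∫ y, G y * densityDeriv p s b z i y| ≤
                (∫ y, |G y| ^ r * p s z y) ^ (1 / r) *
                  (C * Real.exp (ε * (pinnedChain ω₂ lam β γ).hamiltonian N z))

/-- **`DensityScoreDualBoundOn I`** — (MD₂) restricted to the derivative indices in `I`, at all
positive chain parameters. [folklore] -/
def DensityScoreDualBoundOn (I : Set (Fin 4)) : Prop :=
  ∀ ω₂ lam β γ : ℝ, 0 < ω₂ → 0 < lam → 0 < β → 0 < γ → densityScoreDualBodyOn I ω₂ lam β γ

/-- **(SD₁) `DensityScoreDualBoundFirst`** — the ORDER-1 half of (MD₂): the dual `L^q(P_s(z,dy))`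
bound (`q = r/(r−1)`, all `q < ∞`, growth `e^{εH(z)}`, every `ε > 0`, uniformly in `|δ| < δ₀`,
`s ∈ [½, 1]`) of the two FIRST bath-momentum derivatives of the density, `∂_{x_b} p(s,·,y)(z)`
(departure, `i = 0`) and `∂_{y_b} p(s,z,·)` (arrival, `i = 2`) — the norms of the conditioned
first-order Bismut / Skorokhod weights.  WEAKER than (MD₂) (`densityScoreDualBoundFirst_of_md₂`);
implied by (MC∞) ∧ (RW₁) (part V).  [NEW · WEAKER than (MD₂) · ATTACKABLE-L via (RW₁)]
(after Nualart2006, Prop. 2.1.4) (after CuneoEckmannHairerReyBellet2018, Prop. 3.2) [route leaf · named hypothesis of this cell, NOT filed as a route item here] -/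
def DensityScoreDualBoundFirst : Prop :=
  DensityScoreDualBoundOn {0, 2}

/-- **(SD₂) `DensityScoreDualBoundSecond`** — the ORDER-2 half of (MD₂): the same dual bound for
the SECOND derivatives `∂²_{x_b} p(s,·,y)(z)` (`i = 1`) and `∂²_{y_b} p(s,z,·)` (`i = 3`) — the
norms of the iterated (second-order) weights.  WEAKER than (MD₂); with (SD₁) equivalent to it.
[NEW · WEAKER than (MD₂) · ATTACKABLE-XL (native order-2 skeleton identity not yet typed)]
(after Nualart2006, Prop. 2.1.4) (after KusuokaStroock1985, Thm 2.19) [route leaf · named hypothesis of this cell, NOT filed as a route item here] -/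
def DensityScoreDualBoundSecond : Prop :=
  DensityScoreDualBoundOn {1, 3}

/-- Restriction is monotone: the bound on a larger index set gives it on a smaller one.
[folklore] -/
theorem densityScoreDualBodyOn_mono {I J : Set (Fin 4)} (hIJ : I ⊆ J) {ω₂ lam β γ : ℝ}
    (h : densityScoreDualBodyOn J ω₂ lam β γ) : densityScoreDualBodyOn I ω₂ lam β γ := by
  intro T hT N hN r ε hr hε
  obtain ⟨δ₀, C, hδ₀, hC, hmain⟩ := h T hT N hN r ε hr hε
  exact ⟨δ₀, C, hδ₀, hC, fun δ hδ p hp s hs hs1 b hb z G hG hGc i hi =>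
    hmain δ hδ p hp s hs hs1 b hb z G hG hGc i (hIJ hi)⟩

/-- Union: the bounds on `I` and on `J` give the bound on `I ∪ J` (`δ₀ = min`, `C = max`).
[folklore] -/
theorem densityScoreDualBodyOn_union {I J : Set (Fin 4)} {ω₂ lam β γ : ℝ}
    (hI : densityScoreDualBodyOn I ω₂ lam β γ) (hJ : densityScoreDualBodyOn J ω₂ lam β γ) :
    densityScoreDualBodyOn (I ∪ J) ω₂ lam β γ := by
  intro T hT N hN r ε hr hε
  obtain ⟨δ₁, C₁, hδ₁, hC₁, h₁⟩ := hI T hT N hN r ε hr hε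
  obtain ⟨δ₂, C₂, hδ₂, hC₂, h₂⟩ := hJ T hT N hN r ε hr hε
  refine ⟨min δ₁ δ₂, max C₁ C₂, lt_min hδ₁ hδ₂, hC₁.trans (le_max_left _ _),
    fun δ hδ p hp s hs hs1 b hb z G hG hGc i hi => ?_⟩
  have hA : 0 ≤ (∫ y, |G y| ^ r * p s z y) ^ (1 / r) :=
    Real.rpow_nonneg (integral_nonneg fun y => mul_nonneg (Real.rpow_nonneg (abs_nonneg _) _)
      (hp.2.1 s (by linarith) z y)) _
  have hE : 0 ≤ Real.exp (ε * (pinnedChain ω₂ lam β γ).hamiltonian N z) := (Real.exp_pos _).le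
  rcases hi with hi | hi
  · exact (h₁ δ (lt_of_lt_of_le hδ (min_le_left _ _)) p hp s hs hs1 b hb z G hG hGc i hi).trans
      (mul_le_mul_of_nonneg_left (mul_le_mul_of_nonneg_right (le_max_left _ _) hE) hA)
  · exact (h₂ δ (lt_of_lt_of_le hδ (min_le_right _ _)) p hp s hs hs1 b hb z G hG hGc i hi).trans
      (mul_le_mul_of_nonneg_left (mul_le_mul_of_nonneg_right (le_max_right _ _) hE) hA)

/-- (MD₂) is its restriction to all four indices. [folklore] -/
theorem densityScoreDualBound₂_iff_on_univ :
    DensityScoreDualBound₂ ↔ DensityScoreDualBoundOn Set.univ := by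
  constructor
  · intro h ω₂ lam β γ hω hl hβ hγ T hT N hN r ε hr hε
    obtain ⟨δ₀, C, hδ₀, hC, hmain⟩ := h ω₂ lam β γ hω hl hβ hγ T hT N hN r ε hr hε
    exact ⟨δ₀, C, hδ₀, hC, fun δ hδ p hp s hs hs1 b hb z G hG hGc i _ =>
      hmain δ hδ p hp s hs hs1 b hb z G hG hGc i⟩
  · intro h ω₂ lam β γ hω hl hβ hγ T hT N hN r ε hr hε
    obtain ⟨δ₀, C, hδ₀, hC, hmain⟩ := h ω₂ lam β γ hω hl hβ hγ T hT N hN r ε hr hε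
    exact ⟨δ₀, C, hδ₀, hC, fun δ hδ p hp s hs hs1 b hb z G hG hGc i =>
      hmain δ hδ p hp s hs hs1 b hb z G hG hGc i (Set.mem_univ i)⟩

/-- The four indices are the first-order ones and the second-order ones. [folklore] -/
theorem firstOrder_union_secondOrder : ({0, 2} : Set (Fin 4)) ∪ {1, 3} = Set.univ := by
  ext i
  simp only [Set.mem_union, Set.mem_insert_iff, Set.mem_singleton_iff, Set.mem_univ, iff_true]
  fin_cases i <;> simp

/-- ★ **(SD₁) ∧ (SD₂) ⟹ (MD₂)**: the score dual bound is the conjunction of its order-1 and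
order-2 halves. [folklore] -/
theorem densityScoreDualBound₂_of_orders (h₁ : DensityScoreDualBoundFirst)
    (h₂ : DensityScoreDualBoundSecond) : DensityScoreDualBound₂ := by
  rw [densityScoreDualBound₂_iff_on_univ, ← firstOrder_union_secondOrder]
  exact fun ω₂ lam β γ hω hl hβ hγ =>
    densityScoreDualBodyOn_union (h₁ ω₂ lam β γ hω hl hβ hγ) (h₂ ω₂ lam β γ hω hl hβ hγ)

/-- (MD₂) ⟹ (SD₁). [folklore] -/
theorem densityScoreDualBoundFirst_of_md₂ (h : DensityScoreDualBound₂) :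
    DensityScoreDualBoundFirst := fun ω₂ lam β γ hω hl hβ hγ =>
  densityScoreDualBodyOn_mono (Set.subset_univ _)
    ((densityScoreDualBound₂_iff_on_univ.1 h) ω₂ lam β γ hω hl hβ hγ)

/-- (MD₂) ⟹ (SD₂). [folklore] -/
theorem densityScoreDualBoundSecond_of_md₂ (h : DensityScoreDualBound₂) :
    DensityScoreDualBoundSecond := fun ω₂ lam β γ hω hl hβ hγ =>
  densityScoreDualBodyOn_mono (Set.subset_univ _)
    ((densityScoreDualBound₂_iff_on_univ.1 h) ω₂ lam β γ hω hl hβ hγ)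

/-- (MD₂) ⟺ (SD₁) ∧ (SD₂). [folklore] -/
theorem densityScoreDualBound₂_iff_orders :
    DensityScoreDualBound₂ ↔ DensityScoreDualBoundFirst ∧ DensityScoreDualBoundSecond :=
  ⟨fun h => ⟨densityScoreDualBoundFirst_of_md₂ h, densityScoreDualBoundSecond_of_md₂ h⟩,
    fun h => densityScoreDualBound₂_of_orders h.1 h.2⟩

/-! ## 2. (RW₁): Gram-conditional, level-wise moments of the regularised order-1 weights -/

/-- **(RW₁) `GramControlledWeightMoments`** — the ORDER-1 skeleton piece beneath (SD₁),
GRAM-CONDITIONAL and LEVEL-WISE (OPEN · TRUE-leaning · ATTACKABLE-L; incomparable with the summit: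
a statement about explicit finite-dimensional Gaussian functionals of the chain driven at both
ends, at one fixed `N`).  For positive parameters, `T > 0`, `N ≥ 2`, every moment order `q > 1`
and loss rate `ε > 0` there are an inverse-moment order `q' > 0`, a rate `ε' > 0`, `δ₀ > 0`,
`K ≥ 0` and a power `μ : ℕ` — depending on `(T, N, q, ε)` ONLY — such that for every constant
`C₁ ≥ 0`, every `|δ| < δ₀` (baths `T ± δ/2`), every fixed `s ∈ [½, 1]`, both bath sites `b`,
every starting point `z`, every regularisation `κ > 0`, EVERY level `m` and every measurable
`Λ` on the two-bath Wiener space:  IF `Λ` is a frame minorant of the regularised skeleton Gram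
matrix along the path, `Λ(wp)|a|² ≤ aᵀ(Γ_m(wp) + κ)a` for all `wp, a`
(`Γ_m = skelGramPath … s m z wp`, the matrix inverted inside the controls `skelCtrlArr/Dep`),
AND `E[Λ^{-q'}] ≤ (C₁ e^{ε'H(z)})^{q'}` (Lebesgue integral of `(ENNReal.ofReal Λ)⁻¹ ^ q'`, no junk
value), THEN the `q`-th moments (`skelMoment`, Lebesgue integrals) of the regularised arrival
weight `w_{m,κ} = δ_m(Jᵀ(Γ_m+κ)⁻¹e_{p_b})` and of the regularised departure weight
`w'_{m,κ} = δ_m(Jᵀ(Γ_m+κ)⁻¹V)` are both `≤ (K (1 + C₁)^μ e^{εH(z)})^q`.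
WHY TRUE (expected proof, `q' = 4q`, `ε' = ε/4`, `μ = 2`): pathwise `‖(Γ_m+κ)⁻¹‖ ≤ Λ⁻¹`, so
`|w_{m,κ}| ≤ Λ⁻¹(|J x| + 2^{-m}|Σ_j ∂²_{jj}E|) + Λ⁻² 2^{-2m}|Σ_j e(…∂_jJ Jᵀ…)J_{·j}|`; Hölder; the
moments of `Λ⁻¹` are the hypothesis, those of the second factors are LEVEL-UNIFORM Gaussian
moments of the first and second variation of the skeleton flow (tree: `skeletonStartVariationMoments`,
`skeletonSecondVariationMoments`, energy growth `e^{εH}` for every `ε`) and of the Riemann–Itô sum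
`J x = Σ_j ∂_jE_m x_j = J_{s←0} Σ_j (J_{t_j←0}⁻¹σ + O(2^{-m})) x_j` (adapted factorisation, discrete
Burkholder) — NOT in the tree: the load-bearing lemma of this piece.  WHY IT MIGHT FAIL: only
through a level-dependence of the `L^{2q}` norm of `J x` or of `2^{-m} div u` that the heuristic
column count (`‖J‖_F, ‖∂_jJ‖_F ≍ 2^{m/2}`) misses; the quantifier order (`K, μ` before `κ, m, C₁`)
is the one the junction needs and the one the heuristic gives.  NO Hörmander / small-ball content:
with the trivial minorant `Λ = κ` the hypothesis holds with `C₁ = κ⁻¹` and the conclusion is the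
trivial `κ`-dependent bound — the `κ`-UNIFORM constant comes only from (MC∞) (part V).
[NEW · CONDITIONAL skeleton `L^q`-calculus · ATTACKABLE-L]
(after Nualart2006, Prop. 1.3.1, Prop. 1.5.4, Prop. 2.1.4) (after Burkholder1973, Thm 3.2) (after KusuokaStroock1985, Thm 2.19) [route leaf · named hypothesis of this cell, NOT filed as a route item here] -/
def GramControlledWeightMoments : Prop :=
  ∀ ω₂ lam β γ : ℝ, 0 < ω₂ → 0 < lam → 0 < β → 0 < γ →
    ∀ T : ℝ, 0 < T → ∀ (N : ℕ) (hN : 2 ≤ N), ∀ q ε : ℝ, 1 < q → 0 < ε →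
      ∃ (q' ε' δ₀ K : ℝ) (μ : ℕ), 0 < q' ∧ 0 < ε' ∧ 0 < δ₀ ∧ 0 ≤ K ∧
        ∀ C₁ : ℝ, 0 ≤ C₁ → ∀ δ : ℝ, |δ| < δ₀ → ∀ s : ℝ, 1 / 2 ≤ s → s ≤ 1 →
          ∀ b : Fin N, (b = leftBath N hN ∨ b = rightBath N hN) → ∀ z : PhaseSpace N,
            ∀ κ : ℝ, 0 < κ → ∀ (m : ℕ) (Λ : WienerPair → ℝ), Measurable Λ →
              (∀ (wp : WienerPair) (a : Fin N ⊕ Fin N → ℝ),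
                Λ wp * (a ⬝ᵥ a) ≤
                  a ⬝ᵥ ((skelGramPath ω₂ lam β γ N (T + δ / 2) (T - δ / 2) s m z wp +
                    κ • (1 : Matrix (Fin N ⊕ Fin N) (Fin N ⊕ Fin N) ℝ)) *ᵥ a)) →
              ∫⁻ wp, (ENNReal.ofReal (Λ wp))⁻¹ ^ q' ∂wienerPair ≤
                ENNReal.ofReal ((C₁ * Real.exp (ε' * (pinnedChain ω₂ lam β γ).hamiltonian N z)) ^ q') →
              skelMoment m q (skelWeightArr ω₂ lam β γ N (T + δ / 2) (T - δ / 2) s m κ b z) ≤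
                  ENNReal.ofReal ((K * (1 + C₁) ^ μ *
                    Real.exp (ε * (pinnedChain ω₂ lam β γ).hamiltonian N z)) ^ q) ∧
                skelMoment m q (skelWeightDep ω₂ lam β γ N (T + δ / 2) (T - δ / 2) s m κ b z) ≤
                  ENNReal.ofReal ((K * (1 + C₁) ^ μ *
                    Real.exp (ε * (pinnedChain ω₂ lam β γ).hamiltonian N z)) ^ q)

/-! ## 3. (RW₂ᵈ): the order-2 half, conditional on the limit currency (MC∞) -/

/-- **(RW₂ᵈ) `GramConditionalScoreDualSecond`** — the ORDER-2 piece in conditional dual form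
(OPEN · TRUE-leaning · ATTACKABLE-XL): at every positive chain parameter, the body of (MC∞)
(`SkeletonGramLimitInverseMomentsBody`: inverse moments of the monotone limit of the skeleton Gram
floors, all `q < ∞`, growth `e^{εH(z)}`, `s ∈ [½,1]`, `|δ| < δ₀`) IMPLIES the order-2 inequalities
of (MD₂) (`densityScoreDualBodyOn {1, 3}`: `|∫ G ∂²_{x_b}p|, |∫ G ∂²_{y_b}p| ≤ ‖G‖_{L^r(P_s(z,·))}
C e^{εH(z)}`).  WEAKER than (SD₂) (literally: drop the hypothesis); equivalent to (SD₂) modulo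
the PROVED (MC∞) — i.e. a RESIDUAL that hands its prover the non-degeneracy of the Malliavin
matrix and leaves the second-order Gaussian integration by parts: continuous picture `E[∂²G(X_s)]
= E[G(X_s) δ(w u)] = E[G(X_s)(w² − ⟨Dw, u⟩_H)]`, `u = (DX)ᵀγ⁻¹e`, `w = δ(u)` (Nualart Prop. 2.1.4
with a multi-index of length 2); skeleton picture: the order-2 regularised weight
`w_{m,κ}² − 2^{-m}⟨∇w_{m,κ}, u_{m,κ}⟩` and an order-2 identity with two defect terms, whose native
LEVEL-WISE typing (the analogue of (RW₁)) needs third-variation moments of the skeleton flow not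
yet in the tree.  WHY IT MIGHT FAIL: not through the Gram matrix (given) — only if the `L^q` norms
of `∇w_{m,κ}` (third variation `∂³E_m`, and `∂_j` of `(Γ_m+κ)⁻¹` twice) grew with the level.
[NEW · WEAKER than (SD₂) · RESIDUAL modulo (MC∞)]
(after Nualart2006, Prop. 2.1.4) (after KusuokaStroock1985, Thm 2.19) (after HairerMattingly2011spde, Thm 6.7) [route leaf · named hypothesis of this cell, NOT filed as a route item here] -/
def GramConditionalScoreDualSecond : Prop :=
  ∀ ω₂ lam β γ : ℝ, 0 < ω₂ → 0 < lam → 0 < β → 0 < γ →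
    SkeletonGramLimitInverseMomentsBody ω₂ lam β γ → densityScoreDualBodyOn {1, 3} ω₂ lam β γ

/-- (SD₂) ⟹ (RW₂ᵈ): the conditional form is literally weaker. [folklore] -/
theorem gramConditionalScoreDualSecond_of_second (h : DensityScoreDualBoundSecond) :
    GramConditionalScoreDualSecond := fun ω₂ lam β γ hω hl hβ hγ _ =>
  h ω₂ lam β γ hω hl hβ hγ

/-! ## 4. (SW⁰₂) and the order-2 junction -/

/-- **(SW⁰₂) `SkeletonWeightControl₂`** — «what the skeleton IBP machinery needs beyond the Gram
inverse moments» (critic row 1202 (3)(a)), typed as the conjunction of the order-1 level-wise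
piece (RW₁) and the order-2 conditional piece (RW₂ᵈ).  With (MC∞) it gives (MD₂) (part V,
`densityScoreDualBound₂_of_skeletonGramLimitInverseMoments_of_sw`). [cell-local conjunction · formal bookkeeping, not a literature fact] -/
def SkeletonWeightControl₂ : Prop :=
  GramControlledWeightMoments ∧ GramConditionalScoreDualSecond

/-- ★ **The order-2 junction (MC∞) ∧ (RW₂ᵈ) ⟹ (SD₂)** (modus ponens at fixed parameters; `h₁` is
consumed through its body — replace the limit floor by `⊤` in `h₁` and the hypothesis of `h₂` is no
longer met). [folklore] -/
theorem densityScoreDualBoundSecond_of_gram (h₁ : SkeletonGramLimitInverseMoments)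
    (h₂ : GramConditionalScoreDualSecond) : DensityScoreDualBoundSecond :=
  fun ω₂ lam β γ hω hl hβ hγ => h₂ ω₂ lam β γ hω hl hβ hγ (h₁ ω₂ lam β γ hω hl hβ hγ)

end Summit.AtomisticToContinuum.FouriersLaw.Theorems.ExtensiveSnapshotIrreversibility.EnergyWindow

end
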